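import Literature.Probability.RandomPlanarGeometry.TameLevelRectangle
import Literature.Probability.Percolation.QuadCrossingSquareModel
import Summits.CriticalPhenomena.CardyFormulaZ2.Theorems.UnionJackBeffaraMixedInterpolationStubCrossMonoOuter
import HarnessLib

/-!
# Tame brackets exist — stub `stub_tameBrackets` (T1) of line `registered`

Helper file `--supports stmt-CriticalPhenomena-4559` (crux decl
`Summit.CriticalPhenomena.CardyFormulaZ2.Theses.UnionJackBeffara.MixedInterpolation`, skeleton v6
`Cruxes/MixedInterpolation/Lines/birth.lean`), proving EXACTLY the registered statement
`Sig.stub_tameBrackets` as `Registered.stub_tameBrackets`.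

THE STATEMENT.  `R` is a conformal rectangle with square model `F` (`IsSquareModel R F`: the plane
homeomorphism `F` maps the open chart square `(-1,1)²` onto `R.carrier` and side `k` onto `R.arc k`)
and `0 < s ≤ 1/4` a scale.  Then there are TAME conformal rectangles (`C²` boundary loop with
nowhere-vanishing derivative) `R'` — the OUTER bracket: (W1) `F(|re| < 1, |im| < 1-s) ⊆ R'`, (W2) its
closure avoids `R.arc 0 ∪ R.arc 2`, (W3) its frontier inside the bottom / top chart boxes lies on
`R'.arc 0` / `R'.arc 2`, (U1) `closure R' ⊆ F(|re| ≤ 1+s, |im| ≤ 1)`, (U2) arcs 0 / 2 in the bottom /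
top `3s`-strips — and `R''` — the INNER bracket: (N1) `R'' ⊆ R ∪ F(|re| < 1-s, |im| ≥ 1)`, (N2) arcs
0 / 2 strictly below / above the closed chart square, (L) `F(|re| < 1-2s, |im| < 1+s) ⊆ R''`, (N3)
frontier points of chart height `≤ -1+s/32` (`≥ 1-s/32`) and `2s`-far from the lower (upper) unit
corners lie on `R''.arc 0` (`R''.arc 2`), (N4) `R'' ⊆ F(|im| < 1+2s)`.

THE PROOF.  Both brackets are the tame level rectangles of
`Literature.Probability.RandomPlanarGeometry.exists_tame_levelRectangle` (Riemann-map level curves of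
the chart rectangles, Carathéodory boundary correspondence, marks at four lateral chart points;
Schramm–Smirnov's perturbed quads `Q̂₀([x₀,x₁]×[y₀,y₁])`, smoothed): the OUTER one for the chart
rectangle `(-1-s/2, 1+s/2) × (-1+s/2, 1-s/2)` with marks at chart height `∓(1-2s)` and chart wiggle
`s/4`, the INNER one for `(-1+3s/2, 1-3s/2) × (-1-3s/2, 1+3s/2)` with marks at height `∓(1+s/8)` and
wiggle `s/16`.  The fifteen clauses are then chart arithmetic: e.g. for (W3) a frontier point of `R'`
off `R'.arc 0` is `s/4`-close in the chart to a point of the chart rectangle's frontier of height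
`≥ -(1-2s)`, hence has chart height `> -1 + 7s/4 > -1 + 3s/2`; for (N3) a frontier point of `R''` off
`R''.arc 0` and of chart height `≤ -1 + s/32` is `s/16`-close to a LATERAL point `(±(1-3s/2), y)`,
`-1-s/8 ≤ y < -1+3s/32`, hence `(25s/16 + 3s/16 < 2s)`-close to a lower unit corner.

References: O. Schramm, S. Smirnov, *On the scaling limits of planar percolation*, Ann. Probab. 39
(2011), §5 (proof of Lemma 5.1) [SchrammSmirnov2011]; Ch. Pommerenke, *Boundary Behaviour of
Conformal Maps* (1992), Thm. 2.6 [PommerenkeBBCM1992].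
-/

noncomputable section
namespace Summit.CriticalPhenomena.CardyFormulaZ2.Cruxes.MixedInterpolation.Registered

open Set
open Literature.Probability.LatticeModels Literature.Probability.Percolation
open Literature.Probability.RandomPlanarGeometry

/-! ### Chart arithmetic -/

/-- Coordinates of a frontier point of the chart rectangle `(-a, a) × (-b, b)`. [folklore] -/
theorem coords_of_mem_frontier {a b : ℝ} (ha : 0 < a) (hb : 0 < b) {q : ℂ}
    (hq : q ∈ frontier (symRect a b)) : -a ≤ q.re ∧ q.re ≤ a ∧ -b ≤ q.im ∧ q.im ≤ b := by
  rcases (mem_frontier_symRect ha hb).1 hq with ⟨⟨h1, h2⟩, h | h⟩ | ⟨h | h, h3, h4⟩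
  · exact ⟨h1, h2, by rw [h], by rw [h]; linarith⟩
  · exact ⟨h1, h2, by rw [h]; linarith, by rw [h]⟩
  · exact ⟨by rw [h], by rw [h]; linarith, h3, h4⟩
  · exact ⟨by rw [h]; linarith, by rw [h], h3, h4⟩

/-- A chart point coordinatewise `(25s/16, 3s/16)`-close to `(x, y)` is `2s`-close to it. [folklore] -/
theorem dist_lt_two_mul {p : ℂ} {x y s : ℝ} (hre : |p.re - x| < 25 * s / 16)
    (him : |p.im - y| < 3 * s / 16) : dist p ⟨x, y⟩ < 2 * s := by
  have h := Complex.norm_le_abs_re_add_abs_im (p - ⟨x, y⟩)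
  rw [Complex.sub_re, Complex.sub_im] at h
  rw [dist_eq_norm]
  dsimp only at h
  have := abs_nonneg (p.re - x)
  linarith

/-! ### The stub -/

/-- **Stub T1 of line `registered` — tame brackets exist.** For every conformal rectangle `R` with
square model `F` and every scale `0 < s ≤ 1/4` there are TAME conformal rectangles `R'` (outer
bracket, clauses (W1), (W2), (W3), (U1), (U2)) and `R''` (inner bracket, clauses (N1), (N2), (L), (N3),
(N4)) in the prescribed chart boxes: both are Riemann-map level rectangles
(`exists_tame_levelRectangle`) of the chart rectangles `(-1-s/2, 1+s/2) × (-1+s/2, 1-s/2)` (marks at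
chart height `∓(1-2s)`, chart wiggle `s/4`) and `(-1+3s/2, 1-3s/2) × (-1-3s/2, 1+3s/2)` (marks at height
`∓(1+s/8)`, wiggle `s/16`); the clauses follow by chart arithmetic.
[cite: SchrammSmirnov2011, §5 (proof of Lemma 5.1)] -/
theorem stub_tameBrackets :
    ∀ (R : Literature.Probability.RandomPlanarGeometry.ConformalRectangle) (F : ℂ ≃ₜ ℂ), Literature.Probability.Percolation.IsSquareModel R F →
      ∀ s : ℝ, 0 < s → s ≤ 1 / 4 →
        (∃ R' : Literature.Probability.RandomPlanarGeometry.ConformalRectangle,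
          (ContDiff ℝ 2 R'.boundary ∧ ∀ t : ℝ, deriv R'.boundary t ≠ 0) ∧
          F '' {p : ℂ | |p.re| < 1 ∧ |p.im| < 1 - s} ⊆ R'.carrier ∧
          Disjoint (R.arc 0 ∪ R.arc 2) (closure R'.carrier) ∧
          frontier R'.carrier ∩ F '' {p : ℂ | -1 - s ≤ p.re ∧ p.re ≤ 1 + s ∧ -1 - s ≤ p.im ∧ p.im ≤ -1 + 3 * s / 2} ⊆ R'.arc 0 ∧
          frontier R'.carrier ∩ F '' {p : ℂ | -1 - s ≤ p.re ∧ p.re ≤ 1 + s ∧ 1 - 3 * s / 2 ≤ p.im ∧ p.im ≤ 1 + s} ⊆ R'.arc 2 ∧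
          closure R'.carrier ⊆ F '' {p : ℂ | -1 - s ≤ p.re ∧ p.re ≤ 1 + s ∧ -1 ≤ p.im ∧ p.im ≤ 1} ∧
          R'.arc 0 ⊆ F '' {p : ℂ | -1 - s ≤ p.re ∧ p.re ≤ 1 + s ∧ -1 ≤ p.im ∧ p.im ≤ -1 + 3 * s} ∧
          R'.arc 2 ⊆ F '' {p : ℂ | -1 - s ≤ p.re ∧ p.re ≤ 1 + s ∧ 1 - 3 * s ≤ p.im ∧ p.im ≤ 1}) ∧
        (∃ R'' : Literature.Probability.RandomPlanarGeometry.ConformalRectangle,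
          (ContDiff ℝ 2 R''.boundary ∧ ∀ t : ℝ, deriv R''.boundary t ≠ 0) ∧
          R''.carrier ⊆ R.carrier ∪ F '' {p : ℂ | |p.re| < 1 - s ∧ 1 ≤ |p.im|} ∧
          R''.arc 0 ⊆ F '' {p : ℂ | |p.re| < 1 - s ∧ p.im < -1 - s / 32} ∧
          R''.arc 2 ⊆ F '' {p : ℂ | |p.re| < 1 - s ∧ 1 + s / 32 < p.im} ∧
          F '' {p : ℂ | |p.re| < 1 - 2 * s ∧ |p.im| < 1 + s} ⊆ R''.carrier ∧
          frontier R''.carrier ∩ F '' {p : ℂ | p.im ≤ -1 + s / 32 ∧ 2 * s ≤ dist p (1 - Complex.I) ∧ 2 * s ≤ dist p (-1 - Complex.I)} ⊆ R''.arc 0 ∧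
          frontier R''.carrier ∩ F '' {p : ℂ | 1 - s / 32 ≤ p.im ∧ 2 * s ≤ dist p (1 + Complex.I) ∧ 2 * s ≤ dist p (-1 + Complex.I)} ⊆ R''.arc 2 ∧
          R''.carrier ⊆ F '' {p : ℂ | |p.im| < 1 + 2 * s}) := by
  intro R F hF s hs hs4
  obtain ⟨hbot, htop⟩ := outer_chart_arc hF
  constructor
  · -- OUTER bracket: `a = 1 + s/2`, `b = 1 - s/2`, marks at height `∓(1 - 2s)`, wiggle `s/4`
    obtain ⟨R', htame, hcl, hdeep, harc0, harc2, hfr0, hfr2⟩ :=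
      exists_tame_levelRectangle F (a := 1 + s / 2) (b := 1 - s / 2) (h := 1 - 2 * s) (η := s / 4)
        (by linarith) (by linarith) (by linarith) (by linarith)
    have ha : (0 : ℝ) < 1 + s / 2 := by linarith
    have hb : (0 : ℝ) < 1 - s / 2 := by linarith
    refine ⟨R', htame, ?_, ?_, ?_, ?_, ?_, ?_, ?_⟩
    · -- (W1)
      rintro _ ⟨p, ⟨hpre, hpim⟩, rfl⟩
      exact hdeep p (by linarith) (by linarith)
    · -- (W2)
      rw [Set.disjoint_left]
      intro z hz hzc
      obtain ⟨p, hp, rfl⟩ := hcl hzc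
      rw [mem_symRect] at hp
      rcases hz with hz | hz
      · have := hbot _ hz
        rw [Homeomorph.symm_apply_apply] at this
        linarith [hp.2.1]
      · have := htop _ hz
        rw [Homeomorph.symm_apply_apply] at this
        linarith [hp.2.2]
    · -- (W3a)
      rintro z ⟨hzf, p, ⟨-, -, -, hpim⟩, rfl⟩
      rcases hfr0 _ hzf with h | ⟨q, hq, hqim, hd⟩
      · exact h
      · exfalso
        rw [Homeomorph.symm_apply_apply] at hd
        have him := abs_im_sub_lt hd
        rw [abs_lt] at him
        linarith [him.1]
    · -- (W3b)
      rintro z ⟨hzf, p, ⟨-, -, hpim, -⟩, rfl⟩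
      rcases hfr2 _ hzf with h | ⟨q, hq, hqim, hd⟩
      · exact h
      · exfalso
        rw [Homeomorph.symm_apply_apply] at hd
        have him := abs_im_sub_lt hd
        rw [abs_lt] at him
        linarith [him.2]
    · -- (U1)
      intro z hz
      obtain ⟨p, hp, rfl⟩ := hcl hz
      rw [mem_symRect] at hp
      exact ⟨p, ⟨by linarith [hp.1.1], by linarith [hp.1.2], by linarith [hp.2.1],
        by linarith [hp.2.2]⟩, rfl⟩
    · -- (U2a)
      intro z hz
      obtain ⟨q, hq, hqim, hd⟩ := harc0 z hz
      obtain ⟨hre, him⟩ : |_| < _ ∧ |_| < _ := ⟨abs_re_sub_lt hd, abs_im_sub_lt hd⟩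
      obtain ⟨hq1, hq2, hq3, hq4⟩ := coords_of_mem_frontier ha hb hq
      rw [abs_lt] at hre him
      exact ⟨F.symm z, ⟨by linarith, by linarith, by linarith, by linarith⟩, F.apply_symm_apply z⟩
    · -- (U2b)
      intro z hz
      obtain ⟨q, hq, hqim, hd⟩ := harc2 z hz
      obtain ⟨hre, him⟩ : |_| < _ ∧ |_| < _ := ⟨abs_re_sub_lt hd, abs_im_sub_lt hd⟩
      obtain ⟨hq1, hq2, hq3, hq4⟩ := coords_of_mem_frontier ha hb hq
      rw [abs_lt] at hre him
      exact ⟨F.symm z, ⟨by linarith, by linarith, by linarith, by linarith⟩, F.apply_symm_apply z⟩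
  · -- INNER bracket: `a = 1 - 3s/2`, `b = 1 + 3s/2`, marks at height `∓(1 + s/8)`, wiggle `s/16`
    obtain ⟨R'', htame, hcl, hdeep, harc0, harc2, hfr0, hfr2⟩ :=
      exists_tame_levelRectangle F (a := 1 - 3 * s / 2) (b := 1 + 3 * s / 2) (h := 1 + s / 8)
        (η := s / 16) (by linarith) (by linarith) (by linarith) (by linarith)
    have ha : (0 : ℝ) < 1 - 3 * s / 2 := by linarith
    have hb : (0 : ℝ) < 1 + 3 * s / 2 := by linarith
    have e1 : (1 : ℂ) - Complex.I = ⟨1, -1⟩ := Complex.ext (by simp) (by simp)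
    have e2 : (-1 : ℂ) - Complex.I = ⟨-1, -1⟩ := Complex.ext (by simp) (by simp)
    have e3 : (1 : ℂ) + Complex.I = ⟨1, 1⟩ := Complex.ext (by simp) (by simp)
    have e4 : (-1 : ℂ) + Complex.I = ⟨-1, 1⟩ := Complex.ext (by simp) (by simp)
    refine ⟨R'', htame, ?_, ?_, ?_, ?_, ?_, ?_, ?_⟩
    · -- (N1)
      intro z hz
      obtain ⟨p, hp, rfl⟩ := hcl (subset_closure hz)
      rw [mem_symRect] at hp
      by_cases hpi : |p.im| < 1
      · left
        rw [← hF.image_carrier, unitSquareQuad_carrier]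
        rw [abs_lt] at hpi
        exact ⟨p, Complex.mem_reProdIm.2 ⟨⟨by linarith [hp.1.1], by linarith [hp.1.2]⟩, hpi.1, hpi.2⟩,
          rfl⟩
      · right
        exact ⟨p, ⟨by rw [abs_lt]; constructor <;> linarith [hp.1.1, hp.1.2], le_of_not_gt hpi⟩, rfl⟩
    · -- (N2a)
      intro z hz
      obtain ⟨q, hq, hqim, hd⟩ := harc0 z hz
      obtain ⟨hre, him⟩ : |_| < _ ∧ |_| < _ := ⟨abs_re_sub_lt hd, abs_im_sub_lt hd⟩
      obtain ⟨hq1, hq2, hq3, hq4⟩ := coords_of_mem_frontier ha hb hq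
      rw [abs_lt] at hre him
      refine ⟨F.symm z, ⟨?_, by linarith⟩, F.apply_symm_apply z⟩
      rw [abs_lt]; constructor <;> linarith
    · -- (N2b)
      intro z hz
      obtain ⟨q, hq, hqim, hd⟩ := harc2 z hz
      obtain ⟨hre, him⟩ : |_| < _ ∧ |_| < _ := ⟨abs_re_sub_lt hd, abs_im_sub_lt hd⟩
      obtain ⟨hq1, hq2, hq3, hq4⟩ := coords_of_mem_frontier ha hb hq
      rw [abs_lt] at hre him
      refine ⟨F.symm z, ⟨?_, by linarith⟩, F.apply_symm_apply z⟩
      rw [abs_lt]; constructor <;> linarith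
    · -- (L)
      rintro _ ⟨p, ⟨hpre, hpim⟩, rfl⟩
      exact hdeep p (by linarith) (by linarith)
    · -- (N3a)
      rintro z ⟨hzf, p, ⟨hpim, hd1, hd2⟩, rfl⟩
      rcases hfr0 _ hzf with h | ⟨q, hq, hqim, hd⟩
      · exact h
      · exfalso
        rw [Homeomorph.symm_apply_apply] at hd
        obtain ⟨hre, him⟩ : |_| < _ ∧ |_| < _ := ⟨abs_re_sub_lt hd, abs_im_sub_lt hd⟩
        rw [abs_lt] at hre him
        rcases RectLoop.re_eq_of_mem_frontier ha hb hq (by linarith) (by linarith) with hqr | hqr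
        · have := dist_lt_two_mul (p := p) (x := -1) (y := -1) (s := s)
            (by rw [abs_lt]; constructor <;> linarith) (by rw [abs_lt]; constructor <;> linarith)
          rw [← e2] at this
          linarith
        · have := dist_lt_two_mul (p := p) (x := 1) (y := -1) (s := s)
            (by rw [abs_lt]; constructor <;> linarith) (by rw [abs_lt]; constructor <;> linarith)
          rw [← e1] at this
          linarith
    · -- (N3b)
      rintro z ⟨hzf, p, ⟨hpim, hd1, hd2⟩, rfl⟩
      rcases hfr2 _ hzf with h | ⟨q, hq, hqim, hd⟩
      · exact h
      · exfalso
        rw [Homeomorph.symm_apply_apply] at hd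
        obtain ⟨hre, him⟩ : |_| < _ ∧ |_| < _ := ⟨abs_re_sub_lt hd, abs_im_sub_lt hd⟩
        rw [abs_lt] at hre him
        rcases RectLoop.re_eq_of_mem_frontier ha hb hq (by linarith) (by linarith) with hqr | hqr
        · have := dist_lt_two_mul (p := p) (x := -1) (y := 1) (s := s)
            (by rw [abs_lt]; constructor <;> linarith) (by rw [abs_lt]; constructor <;> linarith)
          rw [← e4] at this
          linarith
        · have := dist_lt_two_mul (p := p) (x := 1) (y := 1) (s := s)
            (by rw [abs_lt]; constructor <;> linarith) (by rw [abs_lt]; constructor <;> linarith)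
          rw [← e3] at this
          linarith
    · -- (N4)
      intro z hz
      obtain ⟨p, hp, rfl⟩ := hcl (subset_closure hz)
      rw [mem_symRect] at hp
      exact ⟨p, by rw [mem_setOf_eq, abs_lt]; constructor <;> linarith [hp.2.1, hp.2.2], rfl⟩

end Summit.CriticalPhenomena.CardyFormulaZ2.Cruxes.MixedInterpolation.Registered

end
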